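import Summits.ResolutionOfSingularities.ResolutionOfSingularities.Theorems.SandwichedSingularitiesResolution
import Literature.AlgebraicGeometry.Resolution.ProperModelsPatching
import Literature.AlgebraicGeometry.Resolution.BlowupsProperProofs
import Literature.AlgebraicGeometry.Resolution.BlowupsIntegral
import Literature.AlgebraicGeometry.Resolution.CanonicalResolutionProofs
import Mathlib.AlgebraicGeometry.Noetherian
import HarnessLib

/-!
# Crux `PatchingRel` (stmt-ResolutionOfSingularities-0642), line `sandwiched-gluing` (v3 cut),
# stub `stub_sandwichedStrong_of_sandwichedStrongBlowup`: SAND⁺ᵇ(p) ⇒ SAND⁺(p)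

**A Sing-admissible blowing up with regular source is a strong resolution.** Let `V` be an
integral scheme locally of finite type over a field `k`, `J ≠ 0` a (quasi-coherent) ideal sheaf on
`V` whose cosupport `V(J)` consists of singular points of `V`, and `π : V' → V` a blowing up of
`V` along `J` with `V'` regular. Then

* `π` is proper (blowing ups of locally Noetherian schemes are projective, Görtz–Wedhorn I,
  Prop. 13.96 (1); `IsBlowup.isProper` — `V` is locally Noetherian, being locally of finite type
  over a field) and birational (a blowing up of an integral scheme along a non-zero ideal sheaf,
  Stacks 02ND / 02OS; `IsBlowup.isBirational'`), so `π` is a resolution of singularities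
  (`IsResolution π`);
* the regular locus `Reg V` is OPEN (Matsumura, Cor. to Thm. 30.5: the regular locus of a scheme
  locally of finite type over a field is open; `isOpen_regularLocus_of_locallyOfFiniteType_field`)
  and disjoint from `V(J) ⊆ Sing V`, so `π` restricts to an isomorphism over the open
  `W := Reg V` (a blowing up is an isomorphism away from its centre, Görtz–Wedhorn I,
  Prop. 13.91 (3); `IsBlowup.isIso_morphismRestrict`).

This is `isResolution_and_isIso_regularLocus_of_isBlowup`. Consequently the v3 strong atom in
BLOW-UP FORMAT, SAND⁺ᵇ(p) (`SandwichedStrongBlowupResolution p`: every sandwiched variety `V` —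
integral, proper and birational over a regular integral separated `k`-scheme of finite type `U`,
`char k = p` — carries a non-zero ideal sheaf cosupported in `Sing V` whose blowing up is regular)
implies the gen-0 strong atom SAND⁺(p) (`Literature.AlgebraicGeometry.Resolution.SandwichedStrongResolution p`:
an abstract resolution `π : Y → V` which is an isomorphism over an open `W` with `W = Reg V`):
`sandwichedStrongResolution_of_sandwichedStrongBlowup` (universe polymorphic) and the registered
universe-`0` stub B9 `stub_sandwichedStrong_of_sandwichedStrongBlowup`. The blow-up format is the
one in which strong resolution theorems are proved (Hironaka 1964; Cossart–Jannsen–Saito 2020,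
Thm. 1.2: blowing ups in permissible centres contained in the singular locus); this file records
that it is at least as strong as the abstract format of Cossart–Piltant 2019, Thm. 1.1 (i)–(ii).

Not here: the converse SAND⁺(p) ⇒ SAND⁺ᵇ(p) (a strong resolution need not be ONE blowing up
along an ideal cosupported in `Sing V` without Chow-type/projectivity input), and the bridge
SAND⁺ᵇ(p) ⇒ SANDᵇ(p) (sibling `Theorems/ValuativePatchingRelStrongBlowup.lean`).

## References

* U. Görtz, T. Wedhorn, *Algebraic Geometry I*, 2nd ed. (2020), Prop. 13.91 (3) (a blowing up
  is an isomorphism off its centre), Prop. 13.96 (1) (blowing ups of locally Noetherian schemes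
  are projective). [GortzWedhorn2020]
* The Stacks Project, Tag 02ND (a blowing up of an integral scheme along a non-zero ideal is
  integral and birational), Tag 02OS, Tag 02NS. [StacksProject]
* H. Matsumura, *Commutative Ring Theory* (1987), §30, Cor. to Thm. 30.5 (openness of the
  regular locus of a finitely generated algebra over a field). [Matsumura1987]
* V. Cossart, O. Piltant, *Resolution of singularities of arithmetical threefolds*, J. Algebra
  529 (2019) 268–535, Thm. 1.1 (i)–(ii) (the conclusion shape of SAND⁺). [CossartPiltant2019]
* V. Cossart, U. Jannsen, S. Saito, *Desingularization: invariants and strategy*, LNM 2270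
  (2020), Thm. 1.2 (the blow-up format). [CossartJannsenSaito2020]
-/

-- `Summit.<Summit>.<Sub>.Theorems` with `Sub = Summit` (single-conjunct summit, D-0017): the
-- duplicated namespace component is the tree layout.
set_option linter.dupNamespace false

noncomputable section

namespace Summit.ResolutionOfSingularities.ResolutionOfSingularities.Theorems

open CategoryTheory AlgebraicGeometry
open Literature.AlgebraicGeometry.Resolution
open Summit.ResolutionOfSingularities.ResolutionOfSingularities

universe u

/-- **A Sing-admissible blowing up with regular source is a strong resolution.** For an integral
scheme `V` locally of finite type over a field `k` (`g : V → Spec k`), a non-zero ideal sheaf `J`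
on `V` whose cosupport consists of singular points of `V`, and a blowing up `π : V' → V` of `V`
along `J` with `V'` regular: `π` is a resolution of singularities (proper, `IsBlowup.isProper`,
`V` being locally Noetherian; birational, `IsBlowup.isBirational'`), and it is an isomorphism over
the open `W := Reg V` (open by `isOpen_regularLocus_of_locallyOfFiniteType_field`, disjoint from
the centre `V(J) ⊆ Sing V`, so `IsBlowup.isIso_morphismRestrict` applies). [folklore] -/
theorem isResolution_and_isIso_regularLocus_of_isBlowup {k : Type u} [Field k]
    {V V' : Scheme.{u}} (g : V ⟶ Spec (.of k)) [LocallyOfFiniteType g] [IsIntegral V]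
    {J : V.IdealSheafData} {π : V' ⟶ V} (hJ : J ≠ ⊥)
    (hJsing : ∀ x : V, x ∈ J.support → ¬ IsRegularLocalRing (V.presheaf.stalk x))
    (hπ : IsBlowup π J) (hreg : Scheme.IsRegular V') :
    IsResolution π ∧ ∃ W : V.Opens, (W : Set V) = Scheme.regularLocus V ∧ IsIso (π ∣_ W) := by
  haveI : IsLocallyNoetherian V := LocallyOfFiniteType.isLocallyNoetherian g
  refine ⟨⟨hπ.isProper, hπ.isBirational' hJ, hreg⟩,
    ⟨Scheme.regularLocus V, isOpen_regularLocus_of_locallyOfFiniteType_field g⟩, rfl, ?_⟩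
  -- the open `Reg V` does not meet the centre `V(J) ⊆ Sing V`
  exact hπ.isIso_morphismRestrict
    (Set.disjoint_left.mpr fun x hx hxJ => hJsing x hxJ ((Scheme.mem_regularLocus x).mp hx))

/-- **SAND⁺ᵇ(p) ⇒ SAND⁺(p)**: the strong atom in blow-up format implies the gen-0 strong atom.
Given the data of `SandwichedStrongResolution p` (a field `k` of characteristic `p`, a regular
integral separated `k`-scheme of finite type `U`, an integral `V` proper and birational over `U`
along `η`), SAND⁺ᵇ(p) provides a non-zero ideal sheaf `J` on `V` cosupported in `Sing V` and a
blowing up `π : V' → V` along `J` with `V'` regular; `V` is locally of finite type over `k` along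
`η ≫ f` (`η` proper, `f` locally of finite type), so `π` is a resolution and an isomorphism over
`Reg V` (`isResolution_and_isIso_regularLocus_of_isBlowup`). [folklore] -/
theorem sandwichedStrongResolution_of_sandwichedStrongBlowup {p : ℕ}
    (h : SandwichedStrongBlowupResolution.{u} p) : SandwichedStrongResolution.{u} p := by
  intro k _ _ U V f η hf₁ hf₂ hf₃ hU hUreg hV hη hbir
  haveI := hf₂; haveI := hV; haveI := hη
  obtain ⟨J, V', π, hJ, hJsing, hπ, hreg⟩ := h k U V f η hf₁ hf₂ hf₃ hU hUreg hV hη hbir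
  exact ⟨V', π, isResolution_and_isIso_regularLocus_of_isBlowup (η ≫ f) hJ hJsing hπ hreg⟩

/-- **Registered stub B9 of line `sandwiched-gluing` (v3 cut)** (crux
stmt-ResolutionOfSingularities-0642, universe `0`): SAND⁺ᵇ(p) ⇒ SAND⁺(p) — a Sing-admissible
blowing up of a sandwiched variety with regular source is proper and birational, hence a
resolution, and an isomorphism over the open regular locus, which misses its centre.
[folklore] -/
theorem stub_sandwichedStrong_of_sandwichedStrongBlowup :
    ∀ p : ℕ, SandwichedStrongBlowupResolution.{0} p → SandwichedStrongResolution.{0} p :=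
  fun _ h => sandwichedStrongResolution_of_sandwichedStrongBlowup h

/-- The strong format statement for ALL varieties gives the gen-0 strong atom:
`StrongBlowupResolutionInChar p ⇒` SAND⁺(p) (through SAND⁺ᵇ(p),
`sandwichedStrongBlowupResolution_of_strongBlowupResolutionInChar`). [folklore] -/
theorem sandwichedStrongResolution_of_strongBlowupResolutionInChar {p : ℕ}
    (h : StrongBlowupResolutionInChar.{u} p) : SandwichedStrongResolution.{u} p :=
  sandwichedStrongResolution_of_sandwichedStrongBlowup
    (sandwichedStrongBlowupResolution_of_strongBlowupResolutionInChar h)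

end Summit.ResolutionOfSingularities.ResolutionOfSingularities.Theorems

end
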